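import Summits.NavierStokesRegularity.NavierStokesRegularity.Cruxes.MinimalDatumPFold.SketchIdeator2
import Summits.NavierStokesRegularity.NavierStokesRegularity.Theorems.AxisymmetricExtremalityPFoldToAxisymmetric

/-! # crux-triage r1 k2 — cheap Lean checks (idea `large-p-collapse`: is C⁺ just the crux?) -/

set_option linter.dupNamespace false

open MeasureTheory Set Function Filter Topology
open scoped ENNReal NNReal

namespace Summit.NavierStokesRegularity.NavierStokesRegularity.Cruxes.MinimalDatumPFold.TriageK2

open Literature.Analysis.FluidPDE Literature.Analysis.FunctionSpaces
open Summit.NavierStokesRegularity.NavierStokesRegularity.Theses.AxisymmetricExtremality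
open Summit.NavierStokesRegularity.NavierStokesRegularity.Cruxes.MinimalDatumPFold.Ideator2

local notation "ℝ³" => EuclideanSpace ℝ (Fin 3)
local notation "ℂ³" => EuclideanSpace ℂ (Fin 3)

/-- COSTUME CHECK: the transfer target C⁺ = `AxisymGapClosing` of card `large-p-collapse` is
EQUIVALENT to the crux over the CURRENT tree, with no use of `AngularBesovCollapse` /
`PFoldInfimumCollapse`: (→) is the card's own `minimalDatumPFold_of_axisymGapClosing`
(via p152445); (←) crux ⇒ (proved sibling crux #4) axisymmetric minimal datum ⇒ cheap
axisymmetric blow-up datum for every ε. -/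
theorem axisymGapClosing_iff_minimalDatumPFold : AxisymGapClosing ↔ MinimalDatumPFold := by
  refine ⟨minimalDatumPFold_of_axisymGapClosing, fun h ν hν hclay ε hε => ?_⟩
  obtain ⟨u₀, g, hmin, hax⟩ :=
    Summit.NavierStokesRegularity.NavierStokesRegularity.Theorems.axisymmetricExtremality_pFoldToAxisymmetric_proof
      ν hν (h ν hν hclay)
  obtain ⟨hL3, hrep, hdiv, hnorm, hno⟩ := hmin
  have hfin : rusinSverakRhoMaxPure ν < ⊤ := hnorm ▸ enorm_lt_top
  refine ⟨u₀, g, ⟨hL3, hrep, hdiv, hno⟩, ?_, fun θ => Filter.Eventually.of_forall fun x => hax θ x⟩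
  rw [hnorm]
  exact ENNReal.lt_add_right hfin.ne hε.ne'

/-- Hence the EXACT claim the card attributes to its lever ("given Clay failure,
`stub_symmGapClosing` ⟺ `AxisymGapClosing`") is ALREADY a theorem over the tree, collapse lemma
or not: stub ⇒ crux (p152445) ⇒ C⁺ (above) ⇒ stub (card's trivial direction). -/
theorem symmGapClosing_iff_axisymGapClosing : SymmGapClosing ↔ AxisymGapClosing :=
  ⟨fun h => axisymGapClosing_iff_minimalDatumPFold.2
      (Summit.NavierStokesRegularity.NavierStokesRegularity.Theorems.minimalDatumPFold_of_symmGapClosing h),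
    symmGapClosing_of_axisymGapClosing⟩

/-- And C⁺⁺-style or any other statement `X` with `X → AxisymGapClosing` proved and
`MinimalDatumPFold → X` routine inherits the same circularity; recorded for idea
`dissipation-divergence-radius`, whose card states `AxisymDissipationUnbounded ⟺ AxisymGapClosing`
(modulo GKP literature, not in tree — so not kernel-checkable here). -/
example : AxisymGapClosing ↔ MinimalDatumPFold := axisymGapClosing_iff_minimalDatumPFold

end Summit.NavierStokesRegularity.NavierStokesRegularity.Cruxes.MinimalDatumPFold.TriageK2
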